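import Mathlib
import Summits.ValiantsHypothesis.ValiantsHypothesis.Theorems.BarrierLeverPartitionMinorsHitByVPHiddenStatesSecondShellNestedRows

/-!
# Route BarrierLever — item `PartitionMinorsHitByVP` (stmt-ValiantsHypothesis-19717), line `hidden-states`:
# SECOND-SHELL «EQUAL-Y» CLASSES — toolkit for the third CANCELLATION cell (cyclic digraph, scaled relation)

Helper file (`--supports stmt-ValiantsHypothesis-19717`; cell valiant-natproofs, 𝒟-side door (c), registered line
`Cruxes/PartitionMinorsHitByVP/Lines/hidden_states.lean` v8; prover seat val-np-p6 gen 17).  Closes NO item; definition-free.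

EQUAL-Y classes (memo HOME/val-np-p6/g17/MEMO-valnp6-g17.md §4): `C₁∖A₁ = C₂∖A₂ = {y_b, y_p, y_q}`, attachments
`{x₁,x₂} = A₁∖C₁`, `{q₁,q₂} = A₂∖C₂`; orientation with SWAPPED BOTTOMS: path 1 = (y_b < y_p < y_q), path 2 = (y_p < y_b < y_q).
The reading digraph now has the 2-cycle `y_b ⇄ y_p`, so the row basis `{Z ∪ T}` of the budget-two space degenerates on
`ε₀ε₁ = 1` and the cancellation relation carries the factor `ε₀ε₁ − 1`:
`(ε₀ε₁ − 1)·row(C₂) = Σ_T μ_T · row(Z ∪ T)` (`equalY_budget_identity`, twenty rows, the only pure-attachment pair being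
`{q₁,q₂}`, i.e. the row `A₂`).  THIS FILE: the scaled relation lemma `det_mat_eq_zero_of_rel'`, the polynomial-multiplier
lemma `det_tab2_eq_zero_of_mul` (a cross minor killed by a nonzero polynomial multiple vanishes identically, via `ℂ[ε₀,ε₁]`
being a domain), `X0X1_sub_one_ne_zero`, and the identity (config: `x₁` an inert token of the start row, `x₂` free).
The cell is `…SecondShellEqualY.exists_table_secondShell_equalY` (t = 3 class {012,013;0456,1456}).

HONEST LABEL: conjecture-column cells (second shell, every `t, h`); 19717 stays OPEN; nothing on crux 14610 or VP ≠ VNP.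
-/

set_option linter.dupNamespace false

namespace Summit.ValiantsHypothesis.ValiantsHypothesis.Theorems.BarrierLever.HiddenStates

open Finset

noncomputable section

namespace SecondShell

open PathTable

variable {α : Type} [Fintype α] [DecidableEq α]

/-! ## Scaled relations and polynomial multipliers -/

omit [Fintype α] [DecidableEq α] in
/-- a SCALED relation `c · row i₀ = Σ coef_l · row(R_l)` with `c ≠ 0` kills the determinant. -/
theorem det_mat_eq_zero_of_rel' (w : α → α → ℂ) {r : ℕ} (rows colJ : Fin r → Finset α) (i₀ : Fin r)
    {n : ℕ} (c : ℂ) (hc : c ≠ 0) (coef : Fin n → ℂ) (R : Fin n → Finset α) (hall : ∀ l, ∃ i, i ≠ i₀ ∧ rows i = R l)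
    (hrel : ∀ kk, c * ∏ a ∈ rows i₀, ∑ q ∈ colJ kk, w a q = ∑ l, coef l * ∏ a ∈ R l, ∑ q ∈ colJ kk, w a q) :
    (mat w rows colJ).det = 0 := by
  refine det_mat_eq_zero_of_rel w rows colJ i₀ (fun l => coef l / c) R hall fun kk => ?_
  have h := hrel kk
  have h' : ∏ a ∈ rows i₀, ∑ q ∈ colJ kk, w a q = (∑ l, coef l * ∏ a ∈ R l, ∑ q ∈ colJ kk, w a q) / c := by
    rw [← h]; field_simp
  rw [h', Finset.sum_div]
  refine Finset.sum_congr rfl fun l _ => ?_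
  ring

omit [Fintype α] in
/-- a cross minor killed by a NONZERO POLYNOMIAL multiple vanishes identically (`ℂ[ε₀, ε₁]` is a domain). -/
theorem det_tab2_eq_zero_of_mul (N₁ N₂ : α → α → ℂ) {r : ℕ} (rows colJ : Fin r → Finset α)
    (Q : MvPolynomial (Fin 2) ℂ) (hQ : Q ≠ 0)
    (h : ∀ ε, MvPolynomial.eval ε Q * (mat (tab2 N₁ N₂ ε) rows colJ).det = 0) :
    ∀ ε, (mat (tab2 N₁ N₂ ε) rows colJ).det = 0 := by
  classical
  set P := (mat (tabR N₁ N₂) rows colJ).det with hP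
  have hQP : Q * P = 0 := by
    apply MvPolynomial.funext
    intro ε
    rw [map_mul, map_zero, hP, eval_det_mat_tabR]
    exact h ε
  have hP0 : P = 0 := (mul_eq_zero.1 hQP).resolve_left hQ
  intro ε
  rw [← eval_det_mat_tabR, ← hP, hP0, map_zero]

/-- the multiplier `ε₀ε₁ − 1` is a nonzero polynomial. -/
theorem X0X1_sub_one_ne_zero : (MvPolynomial.X 0 * MvPolynomial.X 1 - 1 : MvPolynomial (Fin 2) ℂ) ≠ 0 := by
  intro h
  have := congrArg (MvPolynomial.eval ![(0 : ℂ), 0]) h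
  simp at this

/-! ## The budget-two identity of the equal-Y class -/

/-- ★ the scaled relation of the equal-Y class (attachment `x₁` inert in the start row, `x₂, q₁, q₂` free): with
`Y_b = n_b + ε₀(1 + n_x) + ε₁ n_p`, `Y_p = n_p + ε₀ n_b + ε₁(n_u + n_v)`, `Y_q = n_q + ε₀ n_p + ε₁ n_b` and at most two of the
six indicators `1`, `(ε₀ε₁ − 1)·Y_b Y_p Y_q` is a fixed combination of twenty smaller products. -/
theorem equalY_budget_identity (e0 e1 : ℂ) (nb np nq nx nu nv : ℕ)
    (hb : nb = 0 ∨ nb = 1) (hp : np = 0 ∨ np = 1) (hq : nq = 0 ∨ nq = 1) (hx : nx = 0 ∨ nx = 1)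
    (hu : nu = 0 ∨ nu = 1) (hv : nv = 0 ∨ nv = 1) (hle : nb + np + nq + nx + nu + nv ≤ 2)
    (Yb Yp Yq : ℂ) (hYb : Yb = nb + e0 * (1 + nx) + e1 * np) (hYp : Yp = np + e0 * nb + e1 * (nu + nv))
    (hYq : Yq = nq + e0 * np + e1 * nb) :
    (e0 * e1 - 1) * (Yb * Yp * Yq) =
      (-e0 ^ 2 * e1 + e0 ^ 2 * e1 ^ 2 - e0 ^ 3 + e0 ^ 3 * e1)
      + (e0 * e1 - e0 * e1 ^ 2 + e0 ^ 2 - e0 ^ 2 * e1) * Yb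
      + (e1 ^ 2 + 2 * e0 * e1 - e0 * e1 ^ 2 + e0 ^ 2 - e0 ^ 2 * e1 - e0 ^ 2 * e1 ^ 2 - e0 ^ 3 * e1) * Yp
      + (e0 ^ 2 - e0 ^ 2 * e1) * Yq
      + (-e0 ^ 2 * e1 + e0 ^ 2 * e1 ^ 2 - e0 ^ 3 + 3 * e0 ^ 3 * e1 - 2 * e0 ^ 4) * nx
      + (-e1 ^ 3 - e1 ^ 4 - e0 * e1 ^ 2 + 2 * e0 * e1 ^ 3 - e0 ^ 2 * e1 + e0 ^ 2 * e1 ^ 2 + e0 ^ 2 * e1 ^ 3) * nu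
      + (-e1 ^ 3 - e1 ^ 4 - e0 * e1 ^ 2 + 2 * e0 * e1 ^ 3 - e0 ^ 2 * e1 + e0 ^ 2 * e1 ^ 2 + e0 ^ 2 * e1 ^ 3) * nv
      + (-e1 - e0 + e0 * e1 ^ 2 + e0 ^ 2 * e1) * (Yb * Yp)
      + (-e0 + e0 * e1) * (Yb * Yq)
      + (-e0 ^ 2 * e1 + e0 ^ 3) * (Yb * nx)
      + (e0 * e1 - e0 * e1 ^ 3) * (Yb * nu)
      + (e0 * e1 - e0 * e1 ^ 3) * (Yb * nv)
      + (-e1 - e0 + e0 * e1 + e0 ^ 2 * e1) * (Yp * Yq)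
      + (e0 * e1 - e0 ^ 3 * e1) * (Yp * nx)
      + (e1 ^ 3 - e0 * e1 ^ 2) * (Yp * nu)
      + (e1 ^ 3 - e0 * e1 ^ 2) * (Yp * nv)
      + (e0 ^ 2 - e0 ^ 2 * e1) * (Yq * nx)
      + (e1 ^ 2 - e0 * e1 ^ 2) * (Yq * nu)
      + (e1 ^ 2 - e0 * e1 ^ 2) * (Yq * nv)
      + (-2 * e1 ^ 4 + 2 * e0 * e1 ^ 3) * ((nu : ℂ) * nv) := by
  subst hYb hYp hYq
  rcases hb with rfl | rfl <;> rcases hp with rfl | rfl <;> rcases hq with rfl | rfl <;> rcases hx with rfl | rfl <;>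
    rcases hu with rfl | rfl <;> rcases hv with rfl | rfl <;> first | (exfalso; omega) | (push_cast; ring)

end SecondShell

end

end Summit.ValiantsHypothesis.ValiantsHypothesis.Theorems.BarrierLever.HiddenStates
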